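import Summits.Ventures.PercRepro.S1RowTwelveCap32
import Summits.Ventures.PercRepro.S1CoreCapThirtyTwo

/-!
# PercRepro — S1 LEVEL FOUR, PHASE 10: C-025 at level `4` for every finite matroid and every `p ≥ 12` (p2, gen 20;
SUBCLAIM-S1 §3 / §6.3 (xxiii))

The row `p = 12` of the `q = 4` window was proved modulo ONE cap — «every `e`-free core of nullity `5` has at most
`32` four-circuits» (S1RowTwelveCap32: `c025_four_twelve_of_cap32`). That cap is now a theorem
(S1CoreCapThirtyTwo: `ncard_fourCircuits_le_thirty_two_uncond` — p1's averaging recursion at nullity `5` on the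
kernel table `s₄ ≤ 18` at nullity `4`). So the row is UNCONDITIONAL: with `p ≥ 13` (phase 9, `c025_four_thirteen`),
`q = 4` holds at every `p ≥ 12`.

* `c025_core_four_twelve` — the core of rank `12` at every corank `≥ 5`;
* `c025_four_twelve_fixed` — `ThmN.RLS M 12 4`;
* **`c025_four_twelve`** — THE END THEOREM: `ThmN.RLS M p 4` for every finite matroid and every `p ≥ 12`;
  `c025_four_twelve'` — the literal `C025` body.
Axioms: standard.
-/

open scoped Matroid

namespace PercRepro

namespace S1

open Set

variable {α : Type}

/-- **The cap of S1RowTwelveCap32 is a theorem**: `s₄ ≤ 32` on every `e`-free core of nullity `5`, in the form the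
row-12 theorems take it. -/
theorem cap32_holds : ∀ (N : Matroid α) [N.Finite],
    (∀ e ∈ N.E, ∃ A ⊆ N.E \ {e}, e ∉ N.closure A ∧ e ∉ N.closure ((N.E \ {e}) \ A)) →
    N.E.encard = N.eRank + ((5 : ℕ) : ℕ∞) → {C : Set α | N.IsCircuit C ∧ C.ncard = 4}.ncard ≤ 32 :=
  fun N _ hfree hd => ncard_fourCircuits_le_thirty_two_uncond N hfree (by exact_mod_cast hd)

/-- **THE CORE OF RANK `12` AT EVERY CORANK `≥ 5`**, unconditionally: `(12, 5)` with LEMMA P's `s₃ ≤ 7` and the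
theorem `s₄ ≤ 32`, `(12, 6)` by LEMMA P and `s₄ ≤ 57`, `(12, 7)` / `(12, 8)` the sub-case cells, `d ≥ 9` by
`cellOK8`. -/
theorem c025_core_four_twelve (M : Matroid α) [M.Finite] (hR : M.eRank = (12 : ℕ)) (hbig : 12 + 4 < M.E.ncard)
    (hfree : ∀ e ∈ M.E, ∃ A ⊆ M.E \ {e}, e ∉ M.closure A ∧ e ∉ M.closure ((M.E \ {e}) \ A)) :
    ThmN.RLS M 12 4 := by
  refine c025_core_four_twelve_of_cap32 M hR hbig hfree ?_
  intro h17
  refine ncard_fourCircuits_le_thirty_two_uncond M hfree ?_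
  rw [hR, ← M.ground_finite.cast_ncard_eq, h17]
  push_cast
  ring

/-- **LEVEL `4` AT RANK `12`** (the fixed-rank frame over level `3` at rank `11`, Theorem M, and the core). -/
theorem c025_four_twelve_fixed (M : Matroid α) [M.Finite] : ThmN.RLS M 12 4 :=
  c025_four_twelve_fixed_of_cap32 cap32_holds M

/-- **C-025 AT LEVEL `4` FOR EVERY `p ≥ 12`** (`p ≥ 13` is phase 9: `c025_four_thirteen`). -/
theorem c025_four_twelve (M : Matroid α) [M.Finite] (p : ℕ) (hp : 12 ≤ p) : ThmN.RLS M p 4 :=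
  c025_four_twelve_of_cap32 cap32_holds M p hp

/-- The phase-10 theorem in the literal vocabulary of `C025` (the body at `(p, 4)`). -/
theorem c025_four_twelve' (M : Matroid α) [M.Finite] (p : ℕ) (hp : 12 ≤ p) :
    phiK p 4 * ({A : Set α | A ⊆ M.E ∧ M.eRk A = (p : ℕ∞) ∧ M.eRk (M.E \ A) = (4 : ℕ∞)}.ncard : ℚ) ≤
      ({A : Set α | A ⊆ M.E ∧ (4 : ℕ∞) < M.eRk A ∧ M.eRk A < (p : ℕ∞)}.ncard : ℚ) :=
  c025_four_twelve M p hp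

end S1

end PercRepro
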